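import Summits.AtomisticToContinuum.BoseEinsteinCondensation.Theorems.FibreConductance.Negative.NearMinimiserFalse

/-!
# Crux `FibreConductance` (stmt-AtomisticToContinuum-9480) — (H1) is not stable under a slack of
# KINETIC ORDER `κ N/L²` either

Crux disprover file (cdisprove cycle 3), a sharpening of `NearMinimiserFalse.lean`
(`not_fibreConductanceNearMinimiser`: the exact-minimiser hypothesis (H1) of the crux cannot be
relaxed to `periodicEnergy v Φ ≤ E₀ + δ` for any FIXED slack `δ > 0`).  Here the slack is allowed to
SHRINK with the datum at the kinetic scale: `FibreConductanceKineticSlack κ` is the crux with (H1)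
replaced by `periodicEnergy v Φ ≤ E₀ + κ·N/L²` — an excess of `κ/L²` per particle, `κ` times the
order of the one-body spectral gap `4π²/L²` of the torus; at the ultra-dilute corner
`L = M²N/4π²` of the window this slack is `16π⁴κ/(M⁴N) → 0`, so it is eventually below every fixed
`δ`.  Still FALSE: `exists_not_fibreConductanceKineticSlack` — there is an absolute `κ₀`
(`= 1024π²K²`, `K` a global bound on the slope of Mathlib's `Real.smoothTransition`) such that
`¬ FibreConductanceKineticSlack κ` for every `κ ≥ κ₀`.  Same witness as cycle 2 (`v = 0`, corner,
`n = e₀`, the two-slab product state, whose excess energy is EXACTLY of kinetic order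
`≤ κ₀N/L²` by `periodicEnergy_slabState_le`, Thomson duality with the chamber-selector test
function), with the energy bookkeeping replaced by the kinetic-order bound.

Reading (numbers, not adjectives): an `N`-uniform energy condition can certify (H1)'s role in the
crux only below `κ₀/L²` per particle; and NO condition of product form can go lower — a product
profile equal to `σ` on a barrier of width `w_b ≤ L` and `1` on a chamber has
`∫|g′|² ≥ (1−σ)²/w_b` with `∫g² ≤ L`, i.e. excess `≥ (1−σ)²/L²` per particle however the barrier is
shaped (recorded in `Cruxes/FibreConductance/Disproof.lean` v7, cycle-3 note (b)); going below
`κ₀` needs correlated rare-bath superpositions.  For provers: (H1) has to enter through the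
Euler–Lagrange equation / unique-continuation structure of the exact ground state, not through any
energy inequality with `N`-uniform slack.  All [folklore].
-/

noncomputable section

namespace Summit.AtomisticToContinuum.BoseEinsteinCondensation.Theorems.FibreConductance.Negative

open MeasureTheory Literature.MathematicalPhysics.QuantumManyBody.BoseGas
open scoped ENNReal NNReal

section Main

open Real
open Summit.AtomisticToContinuum.BoseEinsteinCondensation.Theorems.GaussianDominationCan.Negative

variable {m : ℕ} {L σ : ℝ}

/-- **(H1) relaxed to a kinetic-order slack.** The crux with `periodicEnergy v Φ = E₀` replaced by
`periodicEnergy v Φ ≤ E₀ + κ N/L²` (excess `κ/L²` per particle). -/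
def FibreConductanceKineticSlack (κ : ℝ) : Prop :=
  ∀ v : ℝ → ℝ≥0∞, IsRepulsiveFiniteRange v → (∃ B : ℝ, ∀ r, v r ≤ ENNReal.ofReal B) →
    ∀ M : ℝ, 0 < M → ∃ ρ₀ C : ℝ, 0 < ρ₀ ∧ 0 < C ∧ ∃ N₀ : ℕ,
      ∀ m : ℕ, N₀ ≤ m + 1 → ∀ L : ℝ, 0 < L → ((m + 1 : ℕ) : ℝ) ≤ ρ₀ * L ^ 3 →
        ∀ n : Fin 3 → ℤ, n ≠ 0 → InWindow M m L n →
          ∀ Φ : PeriodicTrialState (m + 1) L,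
            periodicEnergy v Φ ≤ periodicGroundStateEnergy v (m + 1) L +
                ENNReal.ofReal (κ * ((m + 1 : ℕ) : ℝ) / L ^ 2) →
              (∀ X, Φ.ψ X ≠ 0) → FibreBoundAt L n Φ C

/-- A larger slack is a weaker hypothesis, hence a stronger statement (and slack `0` is the crux,
which every `FibreConductanceKineticSlack κ`, `κ ≥ 0`, implies). [folklore] -/
theorem FibreConductanceKineticSlack.mono {κ κ' : ℝ} (hκ : κ ≤ κ') (h : FibreConductanceKineticSlack κ') :
    FibreConductanceKineticSlack κ := by
  intro v hv hB M hM
  obtain ⟨ρ₀, C, hρ, hC, N₀, hmain⟩ := h v hv hB M hM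
  refine ⟨ρ₀, C, hρ, hC, N₀, fun m hm L hL hd n hn hw Φ hE hz => hmain m hm L hL hd n hn hw Φ ?_ hz⟩
  refine hE.trans (add_le_add le_rfl (ENNReal.ofReal_le_ofReal ?_))
  exact div_le_div_of_nonneg_right (mul_le_mul_of_nonneg_right hκ (Nat.cast_nonneg _)) (sq_nonneg _)

/-- **(H1) is not stable under a kinetic-order slack.** There is an absolute `κ₀ > 0` such that the
crux with (H1) relaxed to `periodicEnergy v Φ ≤ E₀ + κ N/L²` is FALSE for every `κ ≥ κ₀`: witness
`v = 0`, the corner `L = M²N/4π²` (`M = 1`), `n = e₀`, the two-slab product state of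
`SlabState.lean` (excess `≤ 1024π²K²·N/L²` EXACTLY of kinetic order, `K` a slope bound of the smooth
step), and Thomson duality with the chamber selector (`TestFunction.lean`): cost
`≥ L²/(16384π²K²σ²) > CL²` for `σ` small. [folklore] -/
theorem exists_not_fibreConductanceKineticSlack :
    ∃ κ₀ : ℝ, 0 < κ₀ ∧ ∀ κ : ℝ, κ₀ ≤ κ → ¬ FibreConductanceKineticSlack κ := by
  obtain ⟨K, hK1, hK⟩ := exists_bound_deriv_smoothTransition
  have hK0 : 0 < K := by linarith
  refine ⟨1024 * π ^ 2 * K ^ 2, by positivity, fun κ hκ h => ?_⟩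
  have h' : FibreConductanceKineticSlack (1024 * π ^ 2 * K ^ 2) := h.mono hκ
  obtain ⟨ρ₀, C, hρ, hC, N₀, hmain⟩ :=
    h' 0 isRepulsiveFiniteRange_zero ⟨0, fun r => by simp⟩ 1 one_pos
  -- choice of `N`: only the corner condition
  obtain ⟨m, hmN, hmT⟩ := exists_large N₀ (64 * π ^ 6 / (ρ₀ * 1 ^ 6))
  obtain ⟨hL, hdens, hwin⟩ := corner one_pos hρ m hmT
  set L : ℝ := 1 ^ 2 * ((m + 1 : ℕ) : ℝ) / (4 * π ^ 2) with hLdef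
  -- choice of the depth `σ`
  set σ : ℝ := min (1 / 3) (1 / (200 * π * K * (C + 1))) with hσdef
  have hσ0 : 0 < σ := lt_min (by norm_num) (by positivity)
  have hσ3 : σ ≤ 1 / 3 := min_le_left _ _
  have hσ1 : σ ≤ 1 := hσ3.trans (by norm_num)
  have hσC : σ ≤ 1 / (200 * π * K * (C + 1)) := min_le_right _ _
  -- the state: its excess energy is of kinetic order
  set Φ := slabState m hL hσ0 hσ1 with hΦ
  have hE : periodicEnergy 0 Φ ≤ periodicGroundStateEnergy 0 (m + 1) L +
      ENNReal.ofReal (1024 * π ^ 2 * K ^ 2 * ((m + 1 : ℕ) : ℝ) / L ^ 2) := by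
    rw [periodicGroundStateEnergy_zero m hL, zero_add]
    refine (periodicEnergy_slabState_le hL hσ0 hσ1 hK).trans (le_of_eq ?_)
    congr 1
    ring
  have hz : ∀ X, Φ.ψ X ≠ 0 := slabState_ne_zero hL hσ0 hσ1
  obtain ⟨J, hJ, hcost⟩ := hmain m hmN L hL hdens e0 e0_ne_zero hwin Φ hE hz
  -- the cost in the form of the duality tool
  rw [norm_e0, one_pow, div_one] at hcost
  have hφpos := slabFactor_pos hL hσ0 hσ1
  have hcost' : ∫⁻ X in cellN (m + 1) L, ENNReal.ofReal ((∑ l : Fin 3, ‖J X l‖ ^ 2) *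
      (bathProd (slabFactor L σ) X / slabFactor L σ (X 0) ^ 2)) ≤ ENNReal.ofReal (C * L ^ 2) := by
    rw [← fibreCost_realProd hφpos (integral_sq_slabFactor hL hσ0.le hσ1)]
    exact hcost
  have hw : ∀ X : Config (m + 1), 0 < bathProd (slabFactor L σ) X / slabFactor L σ (X 0) ^ 2 :=
    fun X => div_pos (bathProd_pos hφpos X) (pow_pos (hφpos _) 2)
  have hwm : Measurable fun X : Config (m + 1) => bathProd (slabFactor L σ) X / slabFactor L σ (X 0) ^ 2 := by
    refine Measurable.div (Finset.measurable_prod _ fun j _ => ?_) ?_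
    · exact ((continuous_slabFactor L σ).pow 2).measurable.comp (measurable_pi_apply j)
    · exact ((continuous_slabFactor L σ).pow 2).measurable.comp (measurable_pi_apply 0)
  have key := norm_pairing_sq_le hJ (contDiff_eta (σ := σ)) (eta_periodic hL.ne') hw hwm
    (by positivity) (by positivity) hcost' (lintegral_dual_le hL hσ0 hσ1 hK)
  have low := norm_pairing_ge (m := m) hL hσ0 hσ3
  -- contradiction: (1/16)² ≤ C L² · 64π²K²σ²/L² = 64π²K²Cσ² < 1/256
  have h1 : (1 / 16 : ℝ) ^ 2 ≤ C * L ^ 2 * (64 * π ^ 2 * K ^ 2 * σ ^ 2 / L ^ 2) :=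
    (pow_le_pow_left₀ (by norm_num) low 2).trans key
  have h2 : C * L ^ 2 * (64 * π ^ 2 * K ^ 2 * σ ^ 2 / L ^ 2) = 64 * π ^ 2 * K ^ 2 * C * σ ^ 2 := by
    field_simp
  rw [h2] at h1
  have h3 : σ * (200 * π * K * (C + 1)) ≤ 1 := by
    rwa [le_div_iff₀ (by positivity)] at hσC
  have h4 : 64 * π ^ 2 * K ^ 2 * C * σ ^ 2 < (1 / 16 : ℝ) ^ 2 := by
    have h5 : (σ * (200 * π * K * (C + 1))) ^ 2 ≤ 1 := by
      have := pow_le_pow_left₀ (by positivity) h3 2; rwa [one_pow] at this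
    have hC1 : C < (C + 1) ^ 2 := by nlinarith
    nlinarith [h5, hC1, Real.pi_pos, hK0, hσ0]
  linarith

end Main

end Summit.AtomisticToContinuum.BoseEinsteinCondensation.Theorems.FibreConductance.Negative

end
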